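import Summits.Ventures.HodgeRepro2.T5SU11SphericalSolutionSpaceAll

/-!
# The Sonin–Pólya energy of the radial equation on the group: `φ_λ² − φ_λ′²/(λ(λ−2))` is monotone in `t ≥ 0`

For the radial equation `sinh 2t · φ″ + 2 cosh 2t · φ′ = μ sinh 2t · φ` of the spherical function `φ = φ_λ(a_t)`,
`μ = λ(λ−2) ≠ 0`, the Sonin–Pólya energy

  **`E_λ(t) = φ_λ(a_t)² − φ_λ′(a_t)²/μ`** has **`E_λ′(t) = 4 cosh 2t · φ_λ′(a_t)²/(μ sinh 2t)`** for `t ≠ 0`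
  (`hasDerivAt_energy`: the cross terms cancel by the equation),

so `E_λ` is monotone on `[0, ∞)` with the sign of `μ`, and `E_λ(0) = 1` (`φ_λ(a_0) = 1`, `φ_λ′(a_0) = 0`):

* **oscillatory window `0 < λ < 2`** (`μ < 0`): `E_λ` is antitone (`energy_antitoneOn`), hence
  **`φ_λ(a_t)² + φ_λ′(a_t)²/(λ(2−λ)) ≤ 1`** for `t ≥ 0` (`energy_le_one`) — the Bernstein-type bound
  `φ_λ′(a_t)² ≤ λ(2−λ)(1 − φ_λ(a_t)²)` (`deriv_sq_le`), `|φ_λ′(a_t)| ≤ √(λ(2−λ)) ≤ 1` (`abs_deriv_le`,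
  `abs_deriv_le_one`), and a second proof of `|φ_λ(a_t)| ≤ 1` (`sq_le_one`);
* **`λ > 2` or `λ < 0`** (`μ > 0`): `E_λ` is monotone (`energy_monotoneOn`), hence
  **`1 + φ_λ′(a_t)²/μ ≤ φ_λ(a_t)²`** (`one_le_energy`) — the logarithmic-derivative bound
  `φ_λ′(a_t)² ≤ μ (φ_λ(a_t)² − 1) ≤ μ φ_λ(a_t)²` (`deriv_sq_le_mu_mul_sq_sub_one`, `deriv_sq_le_mu_mul_sq`),
  consistent with `φ_λ(a_t) ~ c e^{(λ−2)t}` (`(λ−2)² ≤ λ(λ−2)`).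

Nothing is claimed about (N).

Blind lane: Mathlib + the HodgeRepro2 prefix only; no sorry; axioms ⊆ {propext, Classical.choice,
Quot.sound}.
-/

namespace Summit.Ventures.HodgeRepro2.T5SU11SoninPolyaGroup

open Set (Ici Ioi)
open T5SU11Cartan T5SU11OneParameter T5SU11SphericalFunction T5SU11SphericalBounds T5SU11SphericalDeriv
  T5SU11SphericalODE T5SU11SphericalSolutionSpaceAll

section measure

variable [MeasurableSpace Circle] [BorelSpace Circle]

/-- `φ_λ(a_0) = 1`. -/
theorem sph_hyp_zero (lam : ℝ) : sph lam (hyp 0) = 1 := by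
  rw [hyp_zero, sph_one]

/-- **The derivative of the Sonin–Pólya energy**: `E_λ′ = 4 cosh 2t φ_λ′²/(μ sinh 2t)` for `t ≠ 0`. -/
theorem hasDerivAt_energy (lam : ℝ) (hμ : lam * (lam - 2) ≠ 0) {t : ℝ} (ht : t ≠ 0) :
    HasDerivAt (fun t => sph lam (hyp t) ^ 2 - (deriv (fun t => sph lam (hyp t)) t) ^ 2 / (lam * (lam - 2)))
      (4 * Real.cosh (2 * t) * (deriv (fun t => sph lam (hyp t)) t) ^ 2
        / (lam * (lam - 2) * Real.sinh (2 * t))) t := by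
  have hs : Real.sinh (2 * t) ≠ 0 := by
    intro h
    exact ht (by have := Real.sinh_eq_zero.mp h; linarith)
  have h := ((hasDerivAt_sph_hyp_deriv lam t).pow 2).sub
    (((hasDerivAt_deriv_sph_hyp lam t).pow 2).div_const (lam * (lam - 2)))
  refine h.congr_deriv ?_
  have e := sph_hyp_ode_deriv lam t
  have hq : deriv (deriv fun t => sph lam (hyp t)) t
      = (lam * (lam - 2) * Real.sinh (2 * t) * sph lam (hyp t)
          - 2 * Real.cosh (2 * t) * deriv (fun t => sph lam (hyp t)) t) / Real.sinh (2 * t) := by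
    rw [eq_div_iff hs]
    linear_combination e
  simp only [Nat.cast_ofNat, Nat.add_one_sub_one, pow_one]
  rw [hq]
  set μ := lam * (lam - 2) with hμdef
  field_simp
  ring

/-- The energy is differentiable on `ℝ` (at `t = 0` as well, as a combination of differentiable functions). -/
theorem differentiable_energy (lam : ℝ) :
    Differentiable ℝ fun t => sph lam (hyp t) ^ 2 - (deriv (fun t => sph lam (hyp t)) t) ^ 2 / (lam * (lam - 2)) :=
  fun t => (((hasDerivAt_sph_hyp_deriv lam t).pow 2).sub
    (((hasDerivAt_deriv_sph_hyp lam t).pow 2).div_const (lam * (lam - 2)))).differentiableAt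

/-- `E_λ(0) = 1`. -/
theorem energy_zero (lam : ℝ) :
    sph lam (hyp 0) ^ 2 - (deriv (fun t => sph lam (hyp t)) 0) ^ 2 / (lam * (lam - 2)) = 1 := by
  rw [sph_hyp_zero, deriv_sph_hyp_zero]
  ring

/-! ### The oscillatory window `0 < λ < 2` -/

/-- **The energy is antitone on `[0, ∞)` for `0 < λ < 2`.** -/
theorem energy_antitoneOn {lam : ℝ} (h0 : 0 < lam) (h2 : lam < 2) :
    AntitoneOn (fun t => sph lam (hyp t) ^ 2 - (deriv (fun t => sph lam (hyp t)) t) ^ 2 / (lam * (lam - 2)))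
      (Ici 0) := by
  have hμ : lam * (lam - 2) < 0 := mul_neg_of_pos_of_neg h0 (by linarith)
  refine antitoneOn_of_deriv_nonpos (convex_Ici 0) (differentiable_energy lam).continuous.continuousOn
    (fun t _ => (differentiable_energy lam t).differentiableWithinAt) (fun t ht => ?_)
  rw [interior_Ici] at ht
  have ht0 : 0 < t := ht
  rw [(hasDerivAt_energy lam hμ.ne ht0.ne').deriv]
  refine div_nonpos_iff.mpr (Or.inl ⟨?_, ?_⟩)
  · exact mul_nonneg (mul_nonneg (by norm_num) (Real.cosh_pos _).le) (sq_nonneg _)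
  · exact (mul_neg_of_neg_of_pos hμ (Real.sinh_pos_iff.mpr (by linarith))).le

/-- **`φ_λ(a_t)² + φ_λ′(a_t)²/(λ(2−λ)) ≤ 1`** for `t ≥ 0`, `0 < λ < 2`. -/
theorem energy_le_one {lam : ℝ} (h0 : 0 < lam) (h2 : lam < 2) {t : ℝ} (ht : 0 ≤ t) :
    sph lam (hyp t) ^ 2 + (deriv (fun t => sph lam (hyp t)) t) ^ 2 / (lam * (2 - lam)) ≤ 1 := by
  have h := energy_antitoneOn h0 h2 (Set.self_mem_Ici) (Set.mem_Ici.mpr ht) ht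
  simp only at h
  rw [energy_zero] at h
  have e : lam * (2 - lam) = -(lam * (lam - 2)) := by ring
  rw [e, div_neg, ← sub_eq_add_neg]
  exact h

/-- **The Bernstein-type bound** `φ_λ′(a_t)² ≤ λ(2−λ)(1 − φ_λ(a_t)²)` for `t ≥ 0`, `0 < λ < 2`. -/
theorem deriv_sq_le {lam : ℝ} (h0 : 0 < lam) (h2 : lam < 2) {t : ℝ} (ht : 0 ≤ t) :
    (deriv (fun t => sph lam (hyp t)) t) ^ 2 ≤ lam * (2 - lam) * (1 - sph lam (hyp t) ^ 2) := by
  have hκ : 0 < lam * (2 - lam) := mul_pos h0 (by linarith)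
  have h := energy_le_one h0 h2 ht
  have h' : (deriv (fun t => sph lam (hyp t)) t) ^ 2 / (lam * (2 - lam)) ≤ 1 - sph lam (hyp t) ^ 2 := by
    linarith
  rwa [div_le_iff₀ hκ, mul_comm] at h'

/-- **`φ_λ(a_t)² ≤ 1`** for `t ≥ 0`, `0 < λ < 2` (a second proof of `|φ_λ| ≤ 1` on the oscillatory window). -/
theorem sq_le_one {lam : ℝ} (h0 : 0 < lam) (h2 : lam < 2) {t : ℝ} (ht : 0 ≤ t) : sph lam (hyp t) ^ 2 ≤ 1 := by
  have h := energy_le_one h0 h2 ht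
  have hκ : 0 < lam * (2 - lam) := mul_pos h0 (by linarith)
  have : 0 ≤ (deriv (fun t => sph lam (hyp t)) t) ^ 2 / (lam * (2 - lam)) := div_nonneg (sq_nonneg _) hκ.le
  linarith

/-- **`|φ_λ′(a_t)| ≤ √(λ(2−λ))`** for `t ≥ 0`, `0 < λ < 2`. -/
theorem abs_deriv_le {lam : ℝ} (h0 : 0 < lam) (h2 : lam < 2) {t : ℝ} (ht : 0 ≤ t) :
    |deriv (fun t => sph lam (hyp t)) t| ≤ Real.sqrt (lam * (2 - lam)) := by
  have hκ : 0 ≤ lam * (2 - lam) := (mul_pos h0 (by linarith)).le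
  rw [← Real.sqrt_sq_eq_abs]
  refine Real.sqrt_le_sqrt ?_
  have h := deriv_sq_le h0 h2 ht
  have h1 : lam * (2 - lam) * (1 - sph lam (hyp t) ^ 2) ≤ lam * (2 - lam) :=
    mul_le_of_le_one_right hκ (by linarith [sq_nonneg (sph lam (hyp t))])
  exact le_trans h h1

/-- **`|φ_λ′(a_t)| ≤ 1`** for `t ≥ 0`, `0 < λ < 2` (`λ(2−λ) ≤ 1`). -/
theorem abs_deriv_le_one {lam : ℝ} (h0 : 0 < lam) (h2 : lam < 2) {t : ℝ} (ht : 0 ≤ t) :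
    |deriv (fun t => sph lam (hyp t)) t| ≤ 1 := by
  refine le_trans (abs_deriv_le h0 h2 ht) ?_
  rw [Real.sqrt_le_one]
  nlinarith [sq_nonneg (lam - 1)]

/-! ### Outside the window: `λ > 2` or `λ < 0` -/

/-- **The energy is monotone on `[0, ∞)` for `μ = λ(λ−2) > 0`.** -/
theorem energy_monotoneOn {lam : ℝ} (hμ : 0 < lam * (lam - 2)) :
    MonotoneOn (fun t => sph lam (hyp t) ^ 2 - (deriv (fun t => sph lam (hyp t)) t) ^ 2 / (lam * (lam - 2)))
      (Ici 0) := by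
  refine monotoneOn_of_deriv_nonneg (convex_Ici 0) (differentiable_energy lam).continuous.continuousOn
    (fun t _ => (differentiable_energy lam t).differentiableWithinAt) (fun t ht => ?_)
  rw [interior_Ici] at ht
  have ht0 : 0 < t := ht
  rw [(hasDerivAt_energy lam hμ.ne' ht0.ne').deriv]
  refine div_nonneg ?_ ?_
  · exact mul_nonneg (mul_nonneg (by norm_num) (Real.cosh_pos _).le) (sq_nonneg _)
  · exact (mul_pos hμ (Real.sinh_pos_iff.mpr (by linarith))).le

/-- **`1 + φ_λ′(a_t)²/μ ≤ φ_λ(a_t)²`** for `t ≥ 0`, `μ = λ(λ−2) > 0`. -/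
theorem one_le_energy {lam : ℝ} (hμ : 0 < lam * (lam - 2)) {t : ℝ} (ht : 0 ≤ t) :
    1 + (deriv (fun t => sph lam (hyp t)) t) ^ 2 / (lam * (lam - 2)) ≤ sph lam (hyp t) ^ 2 := by
  have h := energy_monotoneOn hμ (Set.self_mem_Ici) (Set.mem_Ici.mpr ht) ht
  simp only at h
  rw [energy_zero] at h
  linarith

/-- **The logarithmic-derivative bound** `φ_λ′(a_t)² ≤ μ (φ_λ(a_t)² − 1)` for `t ≥ 0`, `μ = λ(λ−2) > 0`. -/
theorem deriv_sq_le_mu_mul_sq_sub_one {lam : ℝ} (hμ : 0 < lam * (lam - 2)) {t : ℝ} (ht : 0 ≤ t) :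
    (deriv (fun t => sph lam (hyp t)) t) ^ 2 ≤ lam * (lam - 2) * (sph lam (hyp t) ^ 2 - 1) := by
  have h := one_le_energy hμ ht
  have h' : (deriv (fun t => sph lam (hyp t)) t) ^ 2 / (lam * (lam - 2)) ≤ sph lam (hyp t) ^ 2 - 1 := by
    linarith
  rwa [div_le_iff₀ hμ, mul_comm] at h'

/-- **`φ_λ′(a_t)² ≤ μ φ_λ(a_t)²`** for `t ≥ 0`, `μ = λ(λ−2) > 0`: `|φ_λ′/φ_λ| ≤ √(λ(λ−2))`. -/
theorem deriv_sq_le_mu_mul_sq {lam : ℝ} (hμ : 0 < lam * (lam - 2)) {t : ℝ} (ht : 0 ≤ t) :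
    (deriv (fun t => sph lam (hyp t)) t) ^ 2 ≤ lam * (lam - 2) * sph lam (hyp t) ^ 2 := by
  have h := deriv_sq_le_mu_mul_sq_sub_one hμ ht
  nlinarith [hμ]

end measure

end Summit.Ventures.HodgeRepro2.T5SU11SoninPolyaGroup
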